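import Mathlib
import Literature.NumberTheory.Irrationality.PAdicZetaValues.HurwitzLinearIndependence
import HarnessLib

/-!
# Kawashima–Poëls 2025, Theorem 1.2 (`r = 1`) implies Bel's Theorem 1.1 — PROVED reduction between two named facts

Topic `Literature/NumberTheory/Irrationality/PAdicZetaValues`.  Source: M. Kawashima, A. Poëls, *On the linear independence
of `p`-adic polygamma values*, Mathematika 71 (2025) = arXiv:2410.06789 [KawashimaPoels2025] (held `paper:arxiv-2410.06789`,
chunk p0003 read on the page), §1, the remark after Theorem 1.2:

«`g(m) = (m+1) log(2(m+1)(m+1)^m/m^m) ∼ m log m`.  Consequently, for `r = 1`, we improve Theorem 1.1 [Bel 2010] by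
replacing the condition `log p ≫ m²` with the condition `log p ≫ m log m`.  The table below shows how our condition compares
to that of Bel (B.) for `m ≤ 8`.»

PROOF FILE (theorems only; no definition, no named fact, net debt 0).  The printed "improvement" is made precise for EVERY
`m ≥ 1` (not only asymptotically): Bel's hypothesis `log p ≥ (1 + log 2)(m+1)²` implies the Kawashima–Poëls hypothesis
`(1 + 1/(p−1)) log p > g(m) + m + m(1 + ½ + ⋯ + 1/m)` with `r = 1`, because

**`kpG_add_lt`**: `g(m) + m + m·H_m < (1 + log 2)(m+1)²` for all `m ≥ 1`

(elementary: `log((m+1)/m) ≤ 1/m`, `log x ≤ x/2 + log 2 − 1`, `H_m ≤ 1 + log m` (Mathlib `harmonic_le_one_add_log`), and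
`log 2 > 0.6931` (Mathlib `Real.log_two_gt_d9`); the cases `m = 1, 2`, where `g(m) = 0`, by direct evaluation).  Hence

**`kawashimaPoels2025_theorem11_of_theorem12`**: the tree's named fact `kawashimaPoels2025_theorem12` implies the tree's
named fact `kawashimaPoels2025_theorem11` (Bel 2010) — so a future discharge of Theorem 1.2 discharges Theorem 1.1 too.

Cell zeta5-irr (HONEST FRAMING): a proved implication between two RECORD statements; neither is proved here; nothing about
`ζ(5) ∈ ℝ`.
-/

noncomputable section

namespace Literature.NumberTheory.Irrationality.PAdicZetaValues

/-- `log x ≤ x/2 + log 2 − 1` for `x > 0` (tangent line of `log` at `x = 2`). [folklore] -/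
private theorem log_le_half_add (x : ℝ) (hx : 0 < x) : Real.log x ≤ x / 2 + Real.log 2 - 1 := by
  have h := Real.log_le_sub_one_of_pos (show (0 : ℝ) < x / 2 by positivity)
  rw [Real.log_div hx.ne' two_ne_zero] at h
  linarith

/-- **The comparison of the two hypotheses, for every `m ≥ 1`:** `g(m) + m + m·H_m < (1 + log 2)(m+1)²`
(`g = kpG`, `H_m = harmonic m`). [cite: KawashimaPoels2025, §1 (remark after Thm 1.2: "for r = 1, we improve Theorem 1.1 …"; the table for m ≤ 8)] -/
theorem kpG_add_lt {m : ℕ} (hm : 1 ≤ m) :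
    kpG m + m + m * (harmonic m : ℝ) < (1 + Real.log 2) * ((m : ℝ) + 1) ^ 2 := by
  have hlog := Real.log_two_gt_d9
  have hm0 : (0 : ℝ) < m := by exact_mod_cast hm
  have hH : (harmonic m : ℝ) ≤ 1 + Real.log m := harmonic_le_one_add_log m
  have hB : Real.log ((m : ℝ) + 1) ≤ ((m : ℝ) + 1) / 2 + Real.log 2 - 1 := log_le_half_add _ (by positivity)
  have hlogm : Real.log (m : ℝ) ≤ Real.log ((m : ℝ) + 1) := Real.log_le_log hm0 (by linarith)
  have hlogm0 : 0 ≤ Real.log (m : ℝ) := Real.log_nonneg (by exact_mod_cast hm)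
  by_cases h2 : m ≤ 2
  · -- `m = 1, 2`: `g(m) = 0`
    have hk : kpG m = 0 := by simp [kpG, h2]
    rw [hk, zero_add]
    interval_cases m
    · norm_num [harmonic_succ]
      linarith
    · norm_num [harmonic_succ]
      linarith
  · -- `m ≥ 3`
    have h3 : 3 ≤ m := by omega
    have hm3 : (3 : ℝ) ≤ m := by exact_mod_cast h3
    have hk : kpG m = ((m : ℝ) + 1) * Real.log (2 * ((m : ℝ) + 1) ^ (m + 1) / (m : ℝ) ^ m) := by
      simp [kpG, h2]
    have hA : Real.log (2 * ((m : ℝ) + 1) ^ (m + 1) / (m : ℝ) ^ m) =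
        Real.log 2 + ((m : ℝ) + 1) * Real.log ((m : ℝ) + 1) - m * Real.log m := by
      rw [Real.log_div (by positivity) (by positivity), Real.log_mul (by norm_num) (by positivity), Real.log_pow,
        Real.log_pow]
      push_cast
      ring
    -- `m (log(m+1) − log m) ≤ 1`
    have hC : (m : ℝ) * (Real.log ((m : ℝ) + 1) - Real.log m) ≤ 1 := by
      have h := Real.log_le_sub_one_of_pos (show (0 : ℝ) < ((m : ℝ) + 1) / m by positivity)
      rw [Real.log_div (by positivity) hm0.ne'] at h
      have e : ((m : ℝ) + 1) / m - 1 = 1 / m := by field_simp; ring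
      rw [e] at h
      calc (m : ℝ) * (Real.log ((m : ℝ) + 1) - Real.log m) ≤ m * (1 / m) := mul_le_mul_of_nonneg_left h hm0.le
        _ = 1 := by field_simp
    have hD : Real.log 2 + ((m : ℝ) + 1) * Real.log ((m : ℝ) + 1) - m * Real.log m ≤
        Real.log 2 + Real.log ((m : ℝ) + 1) + 1 := by linarith
    have hE := mul_le_mul_of_nonneg_left hD (by positivity : (0 : ℝ) ≤ (m : ℝ) + 1)
    have hI := mul_le_mul_of_nonneg_left hH hm0.le
    have hF := mul_le_mul_of_nonneg_left hlogm hm0.le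
    have hG := mul_le_mul_of_nonneg_left hB (by positivity : (0 : ℝ) ≤ 2 * m + 1)
    -- the polynomial slack `L m² − (L + ½) m + (½ − L) > 0` for `m ≥ 3` (`L = log 2 > 0.69`)
    have hP : 0 < Real.log 2 * (m : ℝ) ^ 2 - (Real.log 2 + 1 / 2) * m + (1 / 2 - Real.log 2) := by
      have ht : (0 : ℝ) ≤ (m : ℝ) - 3 := by linarith
      nlinarith [mul_nonneg (mul_nonneg ht ht) (show (0 : ℝ) ≤ Real.log 2 by linarith),
        mul_nonneg ht (show (0 : ℝ) ≤ 5 * Real.log 2 - 1 / 2 by linarith)]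
    rw [hk, hA]
    linarith

/-- Bel's hypothesis implies the Kawashima–Poëls hypothesis with `r = 1`:
`(1 + log 2)(m+1)² ≤ log p ⟹ g(m) + m + m H_m < (1 + 1/(p−1)) log p` (`p` prime). [cite: KawashimaPoels2025, §1 (remark after Thm 1.2)] -/
theorem kp_hypothesis_of_bel {p m : ℕ} (hp : p.Prime) (hm : 1 ≤ m)
    (h : (1 + Real.log 2) * ((m : ℝ) + 1) ^ 2 ≤ Real.log p) :
    kpG m + m + m * (harmonic m : ℝ) < (((1 : ℕ) : ℝ) + 1 / ((p : ℝ) - 1)) * Real.log p := by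
  have hp2 : (2 : ℝ) ≤ p := by exact_mod_cast hp.two_le
  have hlogp : 0 ≤ Real.log p := Real.log_nonneg (by linarith)
  have hfrac : 0 ≤ 1 / ((p : ℝ) - 1) := by
    have : (0 : ℝ) < (p : ℝ) - 1 := by linarith
    positivity
  have h1 : Real.log p ≤ (((1 : ℕ) : ℝ) + 1 / ((p : ℝ) - 1)) * Real.log p := by
    push_cast
    nlinarith
  exact ((kpG_add_lt hm).trans_le h).trans_le h1

/-- **Theorem 1.2 (`r = 1`) ⟹ Theorem 1.1 (Bel 2010)**, as an implication between the tree's named facts: «for `r = 1`,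
we improve Theorem 1.1 by replacing the condition `log p ≫ m²` with the condition `log p ≫ m log m`» — made precise for every
`m ≥ 1` by `kpG_add_lt`. [cite: KawashimaPoels2025, §1 (Thm 1.1, Thm 1.2 and the remark after it)] -/
theorem kawashimaPoels2025_theorem11_of_theorem12 (h12 : kawashimaPoels2025_theorem12) :
    kawashimaPoels2025_theorem11 := by
  intro p _ m hm hlog
  have h := h12 p m 1 hm le_rfl (kp_hypothesis_of_bel (Fact.out : p.Prime) hm hlog)
  simpa using h

end Literature.NumberTheory.Irrationality.PAdicZetaValues

end
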